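import Literature.Analysis.FluidPDE.HardSphereCollisionEnumeration
import HarnessLib

/-!
# Windows of collision times: the enumeration as a finite list, and the first `K + 1` collisions
# of each particle in a window

Companion to `Literature.Analysis.FluidPDE.HardSphereCollisionEnumeration` (which proves that
`n ↦ nthTimeAfter S a n` lists the elements of a locally finite `S ⊆ ℝ` after `a` in increasing
order up to any prescribed element `s ∈ S`).  Here the same enumeration is packaged for a WINDOW
`(a, b]` whose right end need not belong to `S` (Gallagher–Saint-Raymond–Texier 2013 Def. 4.1.2 /
Prop. 4.1.1: on the good set the collision times of the flow in a bounded window are finitely many,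
"the collisions `t_1 < ⋯ < t_J` of the window"; Aoki–Pulvirenti–Simonella–Tsuji 2015 §5):

* `nthTimeAfter_window`: with `J = (S ∩ (a, b]).ncard`, the times `nthTimeAfter S a n`, `n < J`,
  lie in `S ∩ (a, b]`, increase strictly, and exhaust `S ∩ (a, b]` (one packaged statement; the
  route file `Theorems/OneFlightGossipEngineEquilibriumClampedCollisionalWindowLDCoinTimesC1` of the
  hydrodynamic-limit problem has problem-side copies of the three clauses);
  `sum_range_ncard_nthTimeAfter` — the corresponding re-indexing of finite sums over a finite set of
  times `S ⊆ (a, b]`;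
* `lt_ncard_window_iff_chain` (origin `a ≥ 0`, where the junk value `0` of the enumerator cannot be
  mistaken for an element after `a`): `n < J` iff `a < t_0 < t_1 < ⋯ < t_n ≤ b` — the form in which
  the event "particle `i` has at least `n + 1` collisions in the window" is measurable;
* along a hard-sphere flow, for a particle `i`, a window `(0, h]` and a threshold `K`
  (`HardSphereFlow.setOf_collisionTimesOf_le_clamp_eq_image`): the collision times of `i` in `(0, h]`
  that are not later than the CLAMP "time of the collision of index `K` if `i` has at least `K + 1`
  collisions in the window, else `h`" are exactly its first `min(J, K + 1)` enumerated collision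
  times; consequently (`HardSphereFlow.ncard_clampedTimes_le`,
  `HardSphereFlow.sum_clampedTimes_eq`) the set of collision times of the window having a participant
  for which they are not later than its clamp has at most `N (K + 1)` elements, and a sum over these
  times of per-participant contributions is the sum over particles of the contributions of their
  first `min(J, K + 1)` collisions — the bookkeeping behind "stop each particle at its `K`-th
  collision" in coarse collision filtrations (Kipnis–Landim 1999 App. 1 §5–6 paradigm).

## Mathlib / Literature reuse

`Set.ncard`, `Set.InjOn.ncard_image`, `Finset.sum_image`, `Finset.sum_comm`, `StrictMonoOn` are
Mathlib's; `nthTimeAfter_enum`, `isLeast_nextTimeAfter`, `nextTimeAfter_of_eq_empty`,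
`IsHardSphereTrajectory.finite_collisionTimesOf_inter_Ioc`, `collisionTimesOf_subset` are the
enumeration / record files'.  No new definitions.

## References

* I. Gallagher, L. Saint-Raymond, B. Texier, *From Newton to Boltzmann* (2013), §4.1, Def. 4.1.2,
  Prop. 4.1.1.
* K. Aoki, M. Pulvirenti, S. Simonella, T. Tsuji, M3AS 25 (2015), §5.
* C. Kipnis, C. Landim, *Scaling Limits of Interacting Particle Systems* (1999), App. 1 §5–6.
-/

open Set Function

namespace Literature.Analysis.FluidPDE

noncomputable section

/-! ## The enumeration of a window `(a, b]` -/

section Enumeration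

variable {S : Set ℝ}

/-- **The enumeration lists a window.** For `S` finite on bounded intervals and `J = (S ∩ (a, b]).ncard`:
the enumerated times `nthTimeAfter S a n`, `n < J`, belong to `S ∩ (a, b]`, increase strictly with
`n`, and every element of `S ∩ (a, b]` is one of them. [folklore] -/
theorem nthTimeAfter_window (hfin : ∀ a b, (S ∩ Ioc a b).Finite) (a b : ℝ) :
    (∀ n < (S ∩ Ioc a b).ncard, nthTimeAfter S a n ∈ S ∩ Ioc a b) ∧
      StrictMonoOn (nthTimeAfter S a) (Iio (S ∩ Ioc a b).ncard) ∧
      nthTimeAfter S a '' Iio (S ∩ Ioc a b).ncard = S ∩ Ioc a b := by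
  rcases (S ∩ Ioc a b).eq_empty_or_nonempty with hE | hne
  · rw [hE, Set.ncard_empty]
    refine ⟨fun n hn => absurd hn (Nat.not_lt_zero n), ?_, by simp⟩
    simp [StrictMonoOn]
  obtain ⟨s, hsF, hsmax⟩ := Set.exists_max_image _ id (hfin a b) hne
  obtain ⟨m, hms, hmem, hmono, hsurj⟩ := nthTimeAfter_enum hfin hsF.1 hsF.2.1
  -- the window is the window `(a, s]`
  have hFs : S ∩ Ioc a b = S ∩ Ioc a s := by
    refine Subset.antisymm (fun u hu => ⟨hu.1, hu.2.1, hsmax u hu⟩) ?_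
    exact fun u hu => ⟨hu.1, hu.2.1, hu.2.2.trans hsF.2.2⟩
  -- and it is the image of `{0, …, m}`
  have himage : nthTimeAfter S a '' Iio (m + 1) = S ∩ Ioc a s := by
    refine Subset.antisymm ?_ fun u hu => ?_
    · rintro _ ⟨n, hn, rfl⟩
      exact hmem n (Nat.lt_succ_iff.1 hn)
    · obtain ⟨n, hn, hnu⟩ := hsurj u hu
      exact ⟨n, Nat.lt_succ_iff.2 hn, hnu⟩
  have hIio : (Iio (m + 1) : Set ℕ) = Iic m := by
    ext n
    exact Nat.lt_succ_iff
  have hmono' : StrictMonoOn (nthTimeAfter S a) (Iio (m + 1)) := by rwa [hIio]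
  have hcard : (S ∩ Ioc a b).ncard = m + 1 := by
    rw [hFs, ← himage, hmono'.injOn.ncard_image, ← Finset.coe_range, Set.ncard_coe_finset,
      Finset.card_range]
  rw [hcard, hFs]
  exact ⟨fun n hn => hmem n (Nat.lt_succ_iff.1 hn), hmono', himage⟩

/-- Every element of the window is enumerated below the window count. [folklore] -/
theorem exists_lt_ncard_nthTimeAfter_eq (hfin : ∀ a b, (S ∩ Ioc a b).Finite) {a b u : ℝ}
    (hu : u ∈ S ∩ Ioc a b) : ∃ n < (S ∩ Ioc a b).ncard, nthTimeAfter S a n = u := by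
  have h := (nthTimeAfter_window hfin a b).2.2
  obtain ⟨n, hn, hnu⟩ := (h.symm ▸ hu : u ∈ nthTimeAfter S a '' Iio (S ∩ Ioc a b).ncard)
  exact ⟨n, hn, hnu⟩

/-- **Chain form of the window count** (origin `a ≥ 0`): `n < (S ∩ (a, b]).ncard` iff
`a < t_0`, `t_k < t_{k+1}` for all `k < n`, and `t_n ≤ b` (`t_k = nthTimeAfter S a k`).  The
hypothesis `0 ≤ a` makes the junk value `0` of the enumerator (no later element) fail `a < t_0`,
resp. `t_k < t_{k+1}`. [folklore] -/
theorem lt_ncard_window_iff_chain (hfin : ∀ a b, (S ∩ Ioc a b).Finite) {a : ℝ} (ha : 0 ≤ a)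
    (b : ℝ) (n : ℕ) :
    n < (S ∩ Ioc a b).ncard ↔
      a < nthTimeAfter S a 0 ∧ (∀ k < n, nthTimeAfter S a k < nthTimeAfter S a (k + 1)) ∧
        nthTimeAfter S a n ≤ b := by
  obtain ⟨hmem, hmono, himage⟩ := nthTimeAfter_window hfin a b
  constructor
  · intro hn
    refine ⟨(hmem 0 (lt_of_le_of_lt (Nat.zero_le n) hn)).2.1, fun k hk => ?_, (hmem n hn).2.2⟩
    exact hmono (show k < _ from hk.trans hn) (show k + 1 < _ from lt_of_le_of_lt hk hn)
      k.lt_succ_self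
  · rintro ⟨h0, hchain, hnb⟩
    -- every `t_k`, `k ≤ n`, is an element of `S` after `a`
    have hS : ∀ k ≤ n, nthTimeAfter S a k ∈ S ∧ a < nthTimeAfter S a k := by
      intro k
      induction k with
      | zero =>
        intro _
        have hne : (S ∩ Ioi a).Nonempty := by
          by_contra hne
          rw [nthTimeAfter_zero, nextTimeAfter_of_eq_empty (not_nonempty_iff_eq_empty.1 hne)] at h0
          exact (not_le.2 h0) ha
        have hl := isLeast_nextTimeAfter (hfin a) hne
        exact ⟨hl.1.1, hl.1.2⟩
      | succ k ih =>
        intro hk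
        obtain ⟨-, hak⟩ := ih (Nat.le_of_succ_le hk)
        have hlt := hchain k (Nat.lt_of_succ_le hk)
        have hne : (S ∩ Ioi (nthTimeAfter S a k)).Nonempty := by
          by_contra hne
          rw [nthTimeAfter_succ, nextTimeAfter_of_eq_empty (not_nonempty_iff_eq_empty.1 hne)] at hlt
          exact (not_le.2 hlt) (ha.trans hak.le)
        have hl := isLeast_nextTimeAfter (hfin _) hne
        rw [← nthTimeAfter_succ] at hl
        exact ⟨hl.1.1, hak.trans hl.1.2⟩
    -- `t_0 < ⋯ < t_n` are `n + 1` distinct elements of the window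
    have hmonoN : StrictMonoOn (nthTimeAfter S a) (Iio (n + 1)) := by
      have h : StrictMonoOn (nthTimeAfter S a) (Iic n) :=
        strictMonoOn_Iic_of_lt_succ fun k hk => hchain k hk
      intro x hx y hy hxy
      exact h (Nat.lt_succ_iff.1 hx) (Nat.lt_succ_iff.1 hy) hxy
    have hsub : nthTimeAfter S a '' Iio (n + 1) ⊆ S ∩ Ioc a b := by
      rintro _ ⟨k, hk, rfl⟩
      have hk' : k ≤ n := Nat.lt_succ_iff.1 hk
      refine ⟨(hS k hk').1, (hS k hk').2, ?_⟩
      exact ((hmonoN.monotoneOn hk (Nat.lt_succ_self n) hk')).trans hnb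
    have hle := Set.ncard_le_ncard hsub (hfin a b)
    rw [hmonoN.injOn.ncard_image, ← Finset.coe_range, Set.ncard_coe_finset, Finset.card_range] at hle
    exact hle

/-- **Re-indexing finite sums by the enumeration.** For a finite set of times `S ⊆ (a, b]`, summing
`F` over `S` is summing `F (nthTimeAfter S a n)` over `n < S.ncard`. [folklore] -/
theorem sum_range_ncard_nthTimeAfter {M : Type*} [AddCommMonoid M] (hS : S.Finite) {a b : ℝ}
    (hab : S ⊆ Ioc a b) (F : ℝ → M) :
    ∑ n ∈ Finset.range S.ncard, F (nthTimeAfter S a n) = ∑ t ∈ hS.toFinset, F t := by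
  classical
  have hfin : ∀ a' b', (S ∩ Ioc a' b').Finite := fun a' b' => hS.subset inter_subset_left
  have hSab : S ∩ Ioc a b = S := inter_eq_left.2 hab
  obtain ⟨-, hmono, himage⟩ := nthTimeAfter_window hfin a b
  rw [hSab] at hmono himage
  have hfs : Finset.image (nthTimeAfter S a) (Finset.range S.ncard) = hS.toFinset := by
    apply Finset.coe_injective
    rw [Finset.coe_image, Finset.coe_range, himage, hS.coe_toFinset]
  rw [← hfs, Finset.sum_image]
  intro x hx y hy hxy
  exact hmono.injOn (by simpa using hx) (by simpa using hy) hxy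

end Enumeration

/-! ## Along a hard-sphere flow: the first `K + 1` collisions of a particle in a window -/

section Kinetic

variable {d : Type*} [Fintype d] {X : Type*} [MeasureTheory.MeasureSpace X] [TopologicalSpace X]
  {N : ℕ} {G : Geometry d X} {ε : ℝ}

namespace HardSphereFlow

variable (Φ : HardSphereFlow G ε N)

/-- On the good set, the collision times of particle `i` of index below the window count
`J = #(collision times of i in (0, h])` lie in the window and are collision times of `i`. [folklore] -/
theorem nthCollisionTimeOf_mem_window {z : Config N d X} (hz : z ∈ Φ.good) (i : Fin N) {h : ℝ}
    {n : ℕ} (hn : n < (collisionTimesOf G ε (fun s => Φ.flow s z) i ∩ Ioc 0 h).ncard) :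
    Φ.nthCollisionTimeOf i n z ∈ collisionTimesOf G ε (fun s => Φ.flow s z) i ∩ Ioc 0 h :=
  (nthTimeAfter_window ((Φ.isTrajectory z hz).finite_collisionTimesOf_inter_Ioc i) 0 h).1 n hn

/-- On the good set, `n ↦ Φ.nthCollisionTimeOf i n z` is strictly increasing below the window count.
[folklore] -/
theorem strictMonoOn_nthCollisionTimeOf_window {z : Config N d X} (hz : z ∈ Φ.good) (i : Fin N)
    (h : ℝ) :
    StrictMonoOn (fun n => Φ.nthCollisionTimeOf i n z)
      (Iio (collisionTimesOf G ε (fun s => Φ.flow s z) i ∩ Ioc 0 h).ncard) :=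
  (nthTimeAfter_window ((Φ.isTrajectory z hz).finite_collisionTimesOf_inter_Ioc i) 0 h).2.1

/-- On the good set, every collision time of `i` in `(0, h]` is enumerated below the window count.
[folklore] -/
theorem exists_lt_ncard_nthCollisionTimeOf_eq {z : Config N d X} (hz : z ∈ Φ.good) (i : Fin N)
    {h u : ℝ} (hu : u ∈ collisionTimesOf G ε (fun s => Φ.flow s z) i ∩ Ioc 0 h) :
    ∃ n < (collisionTimesOf G ε (fun s => Φ.flow s z) i ∩ Ioc 0 h).ncard,
      Φ.nthCollisionTimeOf i n z = u :=
  exists_lt_ncard_nthTimeAfter_eq ((Φ.isTrajectory z hz).finite_collisionTimesOf_inter_Ioc i) hu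

/-- **"At least `n + 1` collisions of `i` in `(0, h]`" in chain form** (good set):
`n < J` iff `0 < t_0 < t_1 < ⋯ < t_n ≤ h`, `t_k = Φ.nthCollisionTimeOf i k z`. [folklore] -/
theorem lt_ncard_collisionTimesOf_window_iff_chain {z : Config N d X} (hz : z ∈ Φ.good) (i : Fin N)
    (h : ℝ) (n : ℕ) :
    n < (collisionTimesOf G ε (fun s => Φ.flow s z) i ∩ Ioc 0 h).ncard ↔
      0 < Φ.nthCollisionTimeOf i 0 z ∧
        (∀ k < n, Φ.nthCollisionTimeOf i k z < Φ.nthCollisionTimeOf i (k + 1) z) ∧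
        Φ.nthCollisionTimeOf i n z ≤ h :=
  lt_ncard_window_iff_chain ((Φ.isTrajectory z hz).finite_collisionTimesOf_inter_Ioc i) le_rfl h n

/-- **The collisions of `i` in the window up to its clamp are its first `min(J, K + 1)` ones.**  On
the good set let `J` be the number of collisions of `i` in `(0, h]`, `t_n = Φ.nthCollisionTimeOf i n z`,
and let the clamp be `max 0 (min h t_K)` if `K + 1 ≤ J` (then it equals `t_K`) and `h` otherwise.
Then the collision times `t` of `i` in `(0, h]` with `t ≤ clamp` are exactly `t_n`, `n < min(J, K+1)`.
[folklore] -/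
theorem setOf_collisionTimesOf_le_clamp_eq_image {z : Config N d X} (hz : z ∈ Φ.good) (i : Fin N)
    (h : ℝ) (K : ℕ) :
    {t | t ∈ collisionTimesOf G ε (fun s => Φ.flow s z) i ∧ t ∈ Ioc 0 h ∧
        t ≤ (if K + 1 ≤ (collisionTimesOf G ε (fun s => Φ.flow s z) i ∩ Ioc 0 h).ncard then
              max 0 (min h (Φ.nthCollisionTimeOf i K z)) else h)} =
      (fun n => Φ.nthCollisionTimeOf i n z) ''
        Iio (min (collisionTimesOf G ε (fun s => Φ.flow s z) i ∩ Ioc 0 h).ncard (K + 1)) := by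
  set J := (collisionTimesOf G ε (fun s => Φ.flow s z) i ∩ Ioc 0 h).ncard with hJ
  obtain ⟨hmem, hmono, himage⟩ :=
    nthTimeAfter_window ((Φ.isTrajectory z hz).finite_collisionTimesOf_inter_Ioc i) 0 h
  change (∀ n < J, Φ.nthCollisionTimeOf i n z ∈ _) at hmem
  change StrictMonoOn (fun n => Φ.nthCollisionTimeOf i n z) (Iio J) at hmono
  change (fun n => Φ.nthCollisionTimeOf i n z) '' Iio J = _ at himage
  by_cases hK : K + 1 ≤ J
  · have hKJ : K < J := hK
    have hclamp : max 0 (min h (Φ.nthCollisionTimeOf i K z)) = Φ.nthCollisionTimeOf i K z := by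
      rw [min_eq_right (hmem K hKJ).2.2, max_eq_right (hmem K hKJ).2.1.le]
    rw [if_pos hK, hclamp, min_eq_right hK]
    ext t
    simp only [mem_setOf_eq, mem_image, mem_Iio]
    constructor
    · rintro ⟨htS, htw, htK⟩
      obtain ⟨n, hn, rfl⟩ := (himage.symm ▸ (⟨htS, htw⟩ : t ∈ _ ∩ Ioc 0 h) :
        t ∈ (fun n => Φ.nthCollisionTimeOf i n z) '' Iio J)
      exact ⟨n, Nat.lt_succ_of_le ((hmono.le_iff_le hn hKJ).1 htK), rfl⟩
    · rintro ⟨n, hn, rfl⟩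
      have hnJ : n < J := lt_of_lt_of_le hn hK
      exact ⟨(hmem n hnJ).1, (hmem n hnJ).2, hmono.monotoneOn hnJ hKJ (Nat.lt_succ_iff.1 hn)⟩
  · rw [if_neg hK, min_eq_left (le_of_lt (not_le.1 hK)), himage]
    ext t
    simp only [mem_setOf_eq, mem_inter_iff]
    constructor
    · rintro ⟨htS, htw, -⟩
      exact ⟨htS, htw⟩
    · rintro ⟨htS, htw⟩
      exact ⟨htS, htw, htw.2⟩

/-- **At most `N (K + 1)` clamped collision times.**  On the good set, the collision times of the
window `(0, h]` having a participant for which they are not later than its clamp (previous lemma)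
are among the `t^i_n`, `i < N`, `n ≤ K`; hence there are finitely many, at most `N (K + 1)`.
[folklore] -/
theorem ncard_clampedTimes_le {z : Config N d X} (hz : z ∈ Φ.good) (h : ℝ) (K : ℕ) :
    ({t | t ∈ collisionTimes G ε (fun s => Φ.flow s z) ∧ t ∈ Ioc 0 h ∧
        ∃ i, Participates G ε (Φ.flow t z) i ∧
          t ≤ (if K + 1 ≤ (collisionTimesOf G ε (fun s => Φ.flow s z) i ∩ Ioc 0 h).ncard then
                max 0 (min h (Φ.nthCollisionTimeOf i K z)) else h)}).ncard ≤ N * (K + 1) := by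
  have hsub : {t | t ∈ collisionTimes G ε (fun s => Φ.flow s z) ∧ t ∈ Ioc 0 h ∧
      ∃ i, Participates G ε (Φ.flow t z) i ∧
        t ≤ (if K + 1 ≤ (collisionTimesOf G ε (fun s => Φ.flow s z) i ∩ Ioc 0 h).ncard then
              max 0 (min h (Φ.nthCollisionTimeOf i K z)) else h)} ⊆
      (fun p : Fin N × Fin (K + 1) => Φ.nthCollisionTimeOf p.1 p.2 z) '' univ := by
    rintro t ⟨-, htw, i, hpi, hti⟩
    have ht : t ∈ (fun n => Φ.nthCollisionTimeOf i n z) ''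
        Iio (min (collisionTimesOf G ε (fun s => Φ.flow s z) i ∩ Ioc 0 h).ncard (K + 1)) := by
      rw [← Φ.setOf_collisionTimesOf_le_clamp_eq_image hz i h K]
      exact ⟨hpi, htw, hti⟩
    obtain ⟨n, hn, rfl⟩ := ht
    exact ⟨(i, ⟨n, lt_of_lt_of_le hn (min_le_right _ _)⟩), mem_univ _, rfl⟩
  refine (Set.ncard_le_ncard hsub (Set.toFinite _)).trans ((Set.ncard_image_le (Set.toFinite _)).trans ?_)
  rw [Set.ncard_univ, Nat.card_prod, Nat.card_eq_fintype_card, Nat.card_eq_fintype_card,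
    Fintype.card_fin, Fintype.card_fin]

/-- **Clamped sums particle by particle.**  On the good set, for a finite set of times `R` equal to
the clamped collision times of the window (previous lemmas) and any per-(time, particle)
contribution `f`, the sum over `t ∈ R` of the contributions of the participants at `t` for which
`t` is not later than their clamp equals the sum over particles `i` and indices `n ≤ K` with `n < J_i`
of the contribution of `i` at its `n`-th collision. [folklore] -/
theorem sum_clampedTimes_eq {M : Type*} [AddCommMonoid M] {z : Config N d X} (hz : z ∈ Φ.good)
    (h : ℝ) (K : ℕ) {R : Set ℝ} (hR : R.Finite)
    (hRdef : R = {t | t ∈ collisionTimes G ε (fun s => Φ.flow s z) ∧ t ∈ Ioc 0 h ∧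
        ∃ i, Participates G ε (Φ.flow t z) i ∧
          t ≤ (if K + 1 ≤ (collisionTimesOf G ε (fun s => Φ.flow s z) i ∩ Ioc 0 h).ncard then
                max 0 (min h (Φ.nthCollisionTimeOf i K z)) else h)})
    (f : ℝ → Fin N → M) [∀ t i, Decidable (Participates G ε (Φ.flow t z) i ∧
      t ≤ (if K + 1 ≤ (collisionTimesOf G ε (fun s => Φ.flow s z) i ∩ Ioc 0 h).ncard then
            max 0 (min h (Φ.nthCollisionTimeOf i K z)) else h))] :
    ∑ t ∈ hR.toFinset, ∑ i, (if Participates G ε (Φ.flow t z) i ∧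
        t ≤ (if K + 1 ≤ (collisionTimesOf G ε (fun s => Φ.flow s z) i ∩ Ioc 0 h).ncard then
              max 0 (min h (Φ.nthCollisionTimeOf i K z)) else h) then f t i else 0) =
      ∑ i, ∑ n ∈ Finset.range (K + 1),
        (if n < (collisionTimesOf G ε (fun s => Φ.flow s z) i ∩ Ioc 0 h).ncard then
          f (Φ.nthCollisionTimeOf i n z) i else 0) := by
  classical
  rw [Finset.sum_comm]
  refine Finset.sum_congr rfl fun i _ => ?_
  set J := (collisionTimesOf G ε (fun s => Φ.flow s z) i ∩ Ioc 0 h).ncard with hJ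
  set clamp := (if K + 1 ≤ J then max 0 (min h (Φ.nthCollisionTimeOf i K z)) else h) with hclamp
  rw [← Finset.sum_filter, ← Finset.sum_filter]
  -- the times of `R` at which `i` is clamped-counted are its first `min J (K+1)` collisions
  have hfilter : hR.toFinset.filter (fun t => Participates G ε (Φ.flow t z) i ∧ t ≤ clamp) =
      (Finset.range (min J (K + 1))).image fun n => Φ.nthCollisionTimeOf i n z := by
    apply Finset.coe_injective
    rw [Finset.coe_filter, Finset.coe_image, Finset.coe_range,
      ← Φ.setOf_collisionTimesOf_le_clamp_eq_image hz i h K]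
    ext t
    simp only [Set.Finite.mem_toFinset, mem_setOf_eq, hRdef]
    constructor
    · rintro ⟨⟨-, htw, -⟩, hpi, hti⟩
      exact ⟨hpi, htw, hti⟩
    · rintro ⟨hpi, htw, hti⟩
      exact ⟨⟨collisionTimesOf_subset _ i hpi, htw, i, hpi, hti⟩, hpi, hti⟩
  have hrange : (Finset.range (K + 1)).filter (fun n => n < J) = Finset.range (min J (K + 1)) := by
    ext n
    simp only [Finset.mem_filter, Finset.mem_range, lt_min_iff]
    exact and_comm
  rw [hfilter, hrange, Finset.sum_image]
  intro x hx y hy hxy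
  have hx' : x < J := lt_of_lt_of_le (Finset.mem_range.1 hx) (min_le_left _ _)
  have hy' : y < J := lt_of_lt_of_le (Finset.mem_range.1 hy) (min_le_left _ _)
  exact (Φ.strictMonoOn_nthCollisionTimeOf_window hz i h).injOn hx' hy' hxy

end HardSphereFlow

end Kinetic

end

end Literature.Analysis.FluidPDE
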